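import Literature.IUT.HodgeTheaters.InitialThetaDataTorsionMonodromy
import Literature.IUT.HodgeTheaters.PiAvatarToFlStarSurjective
import Literature.IUT.HodgeTheaters.InitialThetaDataTorsionProofs
import HarnessLib

/-!
# [IUTchI] Def 6.1 (v) «`Aut(𝒟^{⊚±}) ↠ 𝔽_l^⋇`» at the genuine initial Θ-data: the split-torus sentence `hT` of
# GAP-LEDGER G-w4d065g3-1 DERIVED from the torsion-monodromy datum + Def 3.1 (c) (proof-only companion of
# `InitialThetaDataTorsionMonodromy`; post-freeze additive D13 piece, not a cone member)

S. Mochizuki, *Inter-universal Teichmüller theory I*, kurims manuscript (May 2020), §6 Definition 6.1 (v) p. 158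
l. 12–23 «it follows from the construction of `X̲_K` that, relative to the natural isomorphism `Aut(𝒟^{⊚±}) ⥲
Aut(X̲_K)` …, the image of the above outer homomorphism is equal to a subgroup of `GL₂(𝔽_l)/{±1}` that contains a
Borel subgroup of `SL₂(𝔽_l)/{±1}` … — i.e., the Borel subgroup corresponding to the rank one quotient of
`Δ_X^{ab} ⊗ 𝔽_l` that gives rise to the covering `X̲_K → X_K`.  In particular, this rank one quotient determines a
natural surjective homomorphism `Aut(𝒟^{⊚±}) ↠ 𝔽_l^⋇`», with §3 Definition 3.1 (c) p. 62 «the image of the outer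
homomorphism `G_F → GL₂(𝔽_l)` … contains the subgroup `SL₂(𝔽_l)`» ([IUTchI] Def 6.1 (v) p.158) [claim: Mochizuki2012,
status: disputed] (D-0012 claim key, series status DISPUTED — this file is FINITE GROUP THEORY and linear algebra
mod `l` over abc-iut-L5-t2's REAL `InitialThetaData` and the datum `InitialThetaData.TorsionMonodromy`; nothing of
the series is asserted and no side is taken on [IUTchIII] Cor. 3.12).

## What is proved (for `D : InitialThetaData F K Fbar E l Pb`, `M : D.TorsionMonodromy`)

* §A/§B plumbing (`private` except `fixesTorsion_conj_iff`): `galoisAct_one/_mul`, `fixesTorsion_conj_iff` (`Ker(G_F → GL₂(𝔽_l))` is conjugation-stable),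
  torsion arithmetic `zsmul_eq_zsmul_of_dvd_sub`; mod-`l` inverses `exists_mul_sub_one_dvd_of_not_dvd`,
  `exists_det_one_completion` (a nonzero vector of `𝔽_l²` is the first column of a determinant-one matrix),
  `dvd_val_inv_mul_val_sub_one`.
* §C **`TorsionMonodromy.exists_galois_torus`** — Def 3.1 (c) ⇒ for every `u ∈ 𝔽_l^×` some `σ ∈ G_F` acts on
  `E_F[l](F̄)` by `σ·T ≡ u·T (mod 𝔽_l·gen)` (the split-torus element `S·diag(u⁻¹,u)·S⁻¹` of the Borel subgroup at the
  line `𝔽_l·gen`, realised through `ImageContainsSL2` in its printed integer-matrix form; the `𝔽_l`-linear algebra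
  is carried on `ℤ`-lifts with explicit divisibility witnesses).
* §D cocycle plumbing: `τ(1) = 0`; on `Π_{X_K}` the cocycle is ADDITIVE (`tau_mul_of_mem_PiXK`, `tau_inv…`,
  `tau_pow…`; because `G_K` fixes `E_F[l]`, abc-iut-L5-t2's `mem_galoisSubgroupOf_iff_fixesTorsion`); and
  **`tau_conj : τ(g k g⁻¹) = σ_g · τ(k)`** for `g ∈ Π_{X_F}`, `k ∈ Π_{X_K}`.
* §E `conj_mem_PiXK_iff` (`Π_{X_F}` normalises `Π_{X_K}`) and **`normal_PiXund_subgroupOf_PiXK`** — `Π_{X̲_K} ⊴ Π_{X_K}`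
  (the instance binder of abc-iut-L5-t4's `toFlStarGlobal`, p425994) now FOLLOWS from the datum.
* §F **`TorsionMonodromy.forall_exists_conj`** = the hypothesis `hT` of abc-iut-w4-d065's
  `toFlStarGlobal_surjective_of_forall_exists_conj` (p428973), verbatim: `∀ u, ∃ n ∈ N_{Π_{C_F}}(Π_{X̲_K}), ∀ k ∈ Π_{X_K},
  (k^u)⁻¹ (n k n⁻¹) ∈ Π_{X̲_K}` — `n` = a lift to `Π_{X_F}` (`Π_{X_F} ↠ G_F`, `map_augGF_PiX`) of the torus element.
* §G **`toFlStarGlobal_surjective_of_torsionMonodromy`**, `index_ker_toFlStarGlobal_of_torsionMonodromy`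
  (`[Aut(𝒟^{⊚±}) : Aut_±] = l⋇`).
EFFECT for the layer-5 certificate / KIT-INSTANCE-SPEC P5-binding: the opaque binder `hT` (GAP G-w4d065g3-1) is
REPLACED by the printed datum `Nonempty D.TorsionMonodromy` (strictly more primitive: it also yields the normality
binder and, via `tau_conj`, the action of the full normaliser on `E_F[l]` that G-L5t4g3-3's cusp face consumes).
Proof-only (0 definitions, no instance, no notation); axioms standard. typed ≠ proved elsewhere.
-/

noncomputable section

namespace Literature.IUT.HodgeTheaters

open scoped WeierstrassCurve.Affine Classical

universe u v w

section TorsionMonodromy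

variable {F : Type u} {K : Type v} {Fbar : Type w} [Field F] [NumberField F] [Field K] [NumberField K]
  [Algebra F K] [Field Fbar] [Algebra F Fbar] [Algebra K Fbar]
  {E : WeierstrassCurve F} [E.IsElliptic] {l : ℕ} {Pb : BadPlacePredicates K}

/-! ### §A. Plumbing for the Galois action on `E_F(F̄)` -/

section GaloisAct
variable (E)
omit [NumberField F] [E.IsElliptic] in
/-- `1 ∈ G_F` acts trivially on `E_F(F̄)` (plumbing for `galoisAct`). [folklore] -/
private theorem galoisAct_one (P : GeomPoints Fbar E) : galoisAct E (1 : Fbar ≃ₐ[F] Fbar) P = P := by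
  cases P <;> rfl

omit [NumberField F] [E.IsElliptic] in
/-- The Galois action on `E_F(F̄)` is multiplicative: `(στ)·P = σ·(τ·P)` (plumbing for `galoisAct`). [folklore] -/
private theorem galoisAct_mul (σ τ : Fbar ≃ₐ[F] Fbar) (P : GeomPoints Fbar E) :
    galoisAct E (σ * τ) P = galoisAct E σ (galoisAct E τ P) := by
  cases P <;> rfl

omit [NumberField F] [E.IsElliptic] in
/-- The Galois action preserves `n`-torsion (it is additive). [folklore] -/
private theorem zsmul_galoisAct_eq_zero (σ : Fbar ≃ₐ[F] Fbar) {n : ℤ} {P : GeomPoints Fbar E} (hP : n • P = 0) :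
    n • galoisAct E σ P = 0 := by
  rw [← map_zsmul, hP, map_zero]

omit [NumberField F] [E.IsElliptic] in
/-- `FixesTorsion` is invariant under conjugation in `G_F`: the kernel of `G_F → GL₂(𝔽_l)` (Def 3.1 (c)) is a normal subgroup. ([IUTchI] Def 3.1 (c) p.62) [claim: Mochizuki2012, status: disputed] -/
theorem fixesTorsion_conj_iff (σ ρ : Fbar ≃ₐ[F] Fbar) :
    FixesTorsion E l (σ * ρ * σ⁻¹) ↔ FixesTorsion E l ρ := by
  constructor
  · intro h P hP
    have hσP : (l : ℤ) • galoisAct E σ P = 0 := zsmul_galoisAct_eq_zero E σ hP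
    have h1 := h (galoisAct E σ P) hσP
    rw [galoisAct_mul, galoisAct_mul, ← galoisAct_mul E σ⁻¹ σ, inv_mul_cancel, galoisAct_one] at h1
    have h2 := congrArg (galoisAct E σ⁻¹) h1
    rwa [← galoisAct_mul, inv_mul_cancel, galoisAct_one, ← galoisAct_mul, inv_mul_cancel, galoisAct_one] at h2
  · intro h P hP
    have hσP : (l : ℤ) • galoisAct E σ⁻¹ P = 0 := zsmul_galoisAct_eq_zero E σ⁻¹ hP
    rw [galoisAct_mul, galoisAct_mul, h _ hσP, ← galoisAct_mul, mul_inv_cancel, galoisAct_one]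

omit [NumberField F] [E.IsElliptic] in
/-- `x • P = y • P` for an `n`-torsion point `P` when `n ∣ x - y` (torsion arithmetic). [folklore] -/
private theorem zsmul_eq_zsmul_of_dvd_sub {n : ℤ} {P : GeomPoints Fbar E} (hP : n • P = 0) {x y : ℤ} (h : n ∣ x - y) :
    x • P = y • P := by
  obtain ⟨k, hk⟩ := h
  rw [← sub_eq_zero, sub_eq_add_neg, ← sub_zsmul, hk, mul_zsmul', hP, zsmul_zero]

omit [NumberField F] [E.IsElliptic] in
/-- `x • P = 0` for an `n`-torsion point `P` when `n ∣ x` (torsion arithmetic). [folklore] -/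
private theorem zsmul_eq_zero_of_dvd {n : ℤ} {P : GeomPoints Fbar E} (hP : n • P = 0) {x : ℤ} (h : n ∣ x) :
    x • P = 0 := by
  rw [zsmul_eq_zsmul_of_dvd_sub E hP (y := 0) (by simpa using h), zero_zsmul]

end GaloisAct

/-! ### §B. Elementary number theory mod `l` -/

section ModL

/-- A residue prime to the prime `l` is invertible mod `l` (on `ℤ`-lifts: `l ∣ a·d − 1`). [folklore] -/
private theorem exists_mul_sub_one_dvd_of_not_dvd {l : ℕ} (hl : l.Prime) {a : ℤ} (ha : ¬ (l : ℤ) ∣ a) :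
    ∃ d : ℤ, (l : ℤ) ∣ a * d - 1 := by
  haveI : Fact l.Prime := ⟨hl⟩
  have ha' : (a : ZMod l) ≠ 0 := by rwa [Ne, ZMod.intCast_zmod_eq_zero_iff_dvd]
  refine ⟨(((a : ZMod l)⁻¹).val : ℤ), ?_⟩
  rw [← ZMod.intCast_zmod_eq_zero_iff_dvd]
  push_cast
  rw [ZMod.natCast_zmod_val, mul_inv_cancel₀ ha', sub_self]

/-- A nonzero vector `(a, c)` of `𝔽_l²` is the first column of a matrix `(a b'; c d')` of determinant `1` (mod `l`, on `ℤ`-lifts). [folklore] -/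
private theorem exists_det_one_completion {l : ℕ} (hl : l.Prime) {a c : ℤ} (h : ¬ ((l : ℤ) ∣ a ∧ (l : ℤ) ∣ c)) :
    ∃ b' d' : ℤ, (l : ℤ) ∣ a * d' - b' * c - 1 := by
  by_cases ha : (l : ℤ) ∣ a
  · have hc : ¬ (l : ℤ) ∣ c := fun hc => h ⟨ha, hc⟩
    obtain ⟨e, he⟩ := exists_mul_sub_one_dvd_of_not_dvd hl hc
    exact ⟨-e, 0, by rw [show a * 0 - -e * c - 1 = c * e - 1 by ring]; exact he⟩
  · obtain ⟨d, hd⟩ := exists_mul_sub_one_dvd_of_not_dvd hl ha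
    exact ⟨0, d, by rw [show a * d - 0 * c - 1 = a * d - 1 by ring]; exact hd⟩

/-- `u⁻¹ · u ≡ 1 (mod l)` on the `ℤ`-lifts of `ZMod.val` of a unit and its inverse. [folklore] -/
private theorem dvd_val_inv_mul_val_sub_one {l : ℕ} [NeZero l] (u : (ZMod l)ˣ) :
    (l : ℤ) ∣ (((u⁻¹ : (ZMod l)ˣ) : ZMod l).val : ℤ) * (((u : ZMod l)).val : ℤ) - 1 := by
  rw [← ZMod.intCast_zmod_eq_zero_iff_dvd]
  push_cast
  rw [ZMod.natCast_zmod_val, ZMod.natCast_zmod_val, ← Units.val_mul, inv_mul_cancel, Units.val_one, sub_self]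

end ModL

/-! ### §C. The Borel/torus element of `Gal(K/F)` from Def 3.1 (c) -/

namespace InitialThetaData

variable (D : InitialThetaData F K Fbar E l Pb)

namespace TorsionMonodromy

variable {D} (M : D.TorsionMonodromy)

/-- **The split torus of the Borel subgroup at the line `𝔽_l·gen`, realised in `G_F`** (Def 3.1 (c) `Gal(K/F) ⊇
SL₂(𝔽_l)`): for every unit `u ∈ 𝔽_l^×` there is `σ ∈ G_F` acting on `E_F[l](F̄)` with `σ·T ≡ u·T (mod 𝔽_l·gen)` for
every `l`-torsion `T` (so `σ` stabilises the line and acts by `u` on the rank-one quotient `Q`).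
([IUTchI] Def 6.1 (v) p.158) [claim: Mochizuki2012, status: disputed] -/
theorem exists_galois_torus (u : (ZMod l)ˣ) : ∃ σ : Fbar ≃ₐ[F] Fbar,
    ∀ T : GeomPoints Fbar E, (l : ℤ) • T = 0 →
      ∃ m : ℤ, galoisAct E σ T - ((u : ZMod l).val : ℤ) • T = m • M.gen := by
  haveI : NeZero l := ⟨D.l_prime.ne_zero⟩
  obtain ⟨P, Q, hP, hQ, hindep, hspan, hreal⟩ := D.imageContainsSL2.exists_basis
  obtain ⟨a, c, hgen⟩ := hspan M.gen M.gen_torsion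
  have hac : ¬ ((l : ℤ) ∣ a ∧ (l : ℤ) ∣ c) := by
    rintro ⟨ha, hc⟩
    apply M.gen_ne_zero
    rw [hgen, zsmul_eq_zero_of_dvd E hP ha, zsmul_eq_zero_of_dvd E hQ hc, add_zero]
  obtain ⟨b', d', hS⟩ := exists_det_one_completion D.l_prime hac
  set uu : ℤ := (((u : ZMod l)).val : ℤ) with huu
  set ui : ℤ := (((u⁻¹ : (ZMod l)ˣ) : ZMod l).val : ℤ) with hui
  have ht : (l : ℤ) ∣ ui * uu - 1 := dvd_val_inv_mul_val_sub_one u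
  -- the matrix `S · diag(ui, uu) · S⁻¹` in the basis `(P, Q)`, `S = (a b'; c d')`
  set α : ℤ := a * d' * ui - b' * c * uu with hα
  set β : ℤ := a * b' * (uu - ui) with hβ
  set γ : ℤ := c * d' * (ui - uu) with hγ
  set δ : ℤ := a * d' * uu - b' * c * ui with hδ
  have hdet : (l : ℤ) ∣ α * δ - β * γ - 1 := by
    have : α * δ - β * γ - 1 =
        (ui * uu - 1) * (a * d' - b' * c) ^ 2 + (a * d' - b' * c - 1) * (a * d' - b' * c + 1) := by
      simp only [hα, hβ, hγ, hδ]; ring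
    rw [this]
    exact dvd_add (dvd_mul_of_dvd_left ht _) (dvd_mul_of_dvd_left hS _)
  obtain ⟨σ, hσP, hσQ⟩ := hreal α β γ δ hdet
  refine ⟨σ, fun T hT => ?_⟩
  obtain ⟨x, y, hTxy⟩ := hspan T hT
  refine ⟨(d' * x - b' * y) * (ui - uu), ?_⟩
  have e1 : (l : ℤ) ∣ (x * α + y * β - uu * x - (d' * x - b' * y) * (ui - uu) * a) - 0 := by
    have : (x * α + y * β - uu * x - (d' * x - b' * y) * (ui - uu) * a) - 0 =
        (x * uu) * (a * d' - b' * c - 1) := by simp only [hα, hβ]; ring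
    rw [this]; exact dvd_mul_of_dvd_right hS _
  have e2 : (l : ℤ) ∣ (x * γ + y * δ - uu * y - (d' * x - b' * y) * (ui - uu) * c) - 0 := by
    have : (x * γ + y * δ - uu * y - (d' * x - b' * y) * (ui - uu) * c) - 0 =
        (y * uu) * (a * d' - b' * c - 1) := by simp only [hγ, hδ]; ring
    rw [this]; exact dvd_mul_of_dvd_right hS _
  have key : galoisAct E σ T - uu • T - ((d' * x - b' * y) * (ui - uu)) • M.gen =
      (x * α + y * β - uu * x - (d' * x - b' * y) * (ui - uu) * a) • P +
        (x * γ + y * δ - uu * y - (d' * x - b' * y) * (ui - uu) * c) • Q := by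
    rw [hTxy, hgen, map_add, map_zsmul, map_zsmul, hσP, hσQ]
    module
  rw [← sub_eq_zero, key, zsmul_eq_zsmul_of_dvd_sub E hP e1, zsmul_eq_zsmul_of_dvd_sub E hQ e2, zero_zsmul,
    zero_zsmul, add_zero]


/-! ### §D. Cocycle plumbing: `τ` on `Π_{X_K}` is additive, and `τ(g k g⁻¹) = σ_g · τ(k)` -/

/-- `Π_{X_K} = Π_{X_F} ∩ Π_{C_K} ≤ Π_{X_F}`. ([IUTchI] Def 3.1 (d) p.62) [claim: Mochizuki2012, status: disputed] -/
theorem PiXK_le_PiX : D.PiXK ≤ D.geom.PiX := inf_le_left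

/-- An element of `Π_{C_K} = augGF⁻¹(G_K)` acts trivially on the `l`-torsion (Def 3.1 (c): `G_K = Ker(G_F → GL₂(𝔽_l))`,
abc-iut-L5-t2's `mem_galoisSubgroupOf_iff_fixesTorsion`). ([IUTchI] Def 3.1 (c) p.62) [claim: Mochizuki2012, status: disputed] -/
theorem galoisAct_augGF_eq_self_of_mem_PiCK {k : D.PiC} (hk : k ∈ D.PiCK) {P : GeomPoints Fbar E}
    (hP : (l : ℤ) • P = 0) : galoisAct E (D.augGF k) P = P := by
  rw [D.PiCK_eq_comap_augGF, Subgroup.mem_comap] at hk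
  exact (D.mem_galoisSubgroupOf_iff_fixesTorsion (D.augGF k)).mp hk P hP

/-- `τ(1) = 0`. ([IUTchI] Def 6.1 (v) p.158) [claim: Mochizuki2012, status: disputed] -/
theorem tau_one : M.tau 1 = 0 := by
  have h := M.tau_mul 1 (one_mem _) 1 (one_mem _)
  rw [mul_one, map_one, galoisAct_one] at h
  have h' : M.tau 1 + M.tau 1 = M.tau 1 + 0 := by rw [add_zero]; exact h.symm
  exact add_left_cancel h'

/-- On `Π_{X_K} · Π_{X_F}` the cocycle is additive in the first variable from `Π_{X_K}`: `τ(k h) = τ(k) + τ(h)`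
(`G_K` acts trivially on `E_F[l]`). ([IUTchI] Def 6.1 (v) p.158) [claim: Mochizuki2012, status: disputed] -/
theorem tau_mul_of_mem_PiXK {k h : D.PiC} (hk : k ∈ D.PiXK) (hh : h ∈ D.geom.PiX) :
    M.tau (k * h) = M.tau k + M.tau h := by
  rw [M.tau_mul k (PiXK_le_PiX hk) h hh, galoisAct_augGF_eq_self_of_mem_PiCK hk.2 (M.tau_torsion h hh)]

/-- `τ(k⁻¹) = −τ(k)` for `k ∈ Π_{X_K}`. ([IUTchI] Def 6.1 (v) p.158) [claim: Mochizuki2012, status: disputed] -/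
theorem tau_inv_of_mem_PiXK {k : D.PiC} (hk : k ∈ D.PiXK) : M.tau k⁻¹ = -M.tau k := by
  have h := M.tau_mul_of_mem_PiXK (inv_mem hk) (PiXK_le_PiX hk)
  rw [inv_mul_cancel, tau_one] at h
  exact (neg_eq_of_add_eq_zero_left h.symm).symm

/-- `τ(k^n) = n·τ(k)` for `k ∈ Π_{X_K}`. ([IUTchI] Def 6.1 (v) p.158) [claim: Mochizuki2012, status: disputed] -/
theorem tau_pow_of_mem_PiXK {k : D.PiC} (hk : k ∈ D.PiXK) (n : ℕ) : M.tau (k ^ n) = (n : ℤ) • M.tau k := by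
  induction n with
  | zero => rw [pow_zero, tau_one, Nat.cast_zero, zero_zsmul]
  | succ n ih =>
    rw [pow_succ, M.tau_mul_of_mem_PiXK (pow_mem hk n) (PiXK_le_PiX hk), ih, Nat.cast_succ, add_zsmul, one_zsmul]

/-- **`τ(g k g⁻¹) = σ_g · τ(k)`** for `g ∈ Π_{X_F}`, `k ∈ Π_{X_K}`: conjugation by `Π_{X_F}` acts on `Π_{X_K}/Ker τ ≅ E_F[l]`
through «the Galois action on `Δ_X^{ab} ⊗ 𝔽_l`». ([IUTchI] Def 6.1 (v) p.158) [claim: Mochizuki2012, status: disputed] -/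
theorem tau_conj {g k : D.PiC} (hg : g ∈ D.geom.PiX) (hk : k ∈ D.PiXK) :
    M.tau (g * k * g⁻¹) = galoisAct E (D.augGF g) (M.tau k) := by
  have hkX : k ∈ D.geom.PiX := PiXK_le_PiX hk
  have h1 := M.tau_mul (g * k) (mul_mem hg hkX) g⁻¹ (inv_mem hg)
  have h2 := M.tau_mul g hg k hkX
  have h3 := M.tau_mul g hg g⁻¹ (inv_mem hg)
  rw [mul_inv_cancel, tau_one] at h3
  have hfix : galoisAct E (D.augGF k) (M.tau g⁻¹) = M.tau g⁻¹ :=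
    galoisAct_augGF_eq_self_of_mem_PiCK hk.2 (M.tau_torsion _ (inv_mem hg))
  rw [h1, h2, map_mul, galoisAct_mul, hfix]
  calc M.tau g + galoisAct E (D.augGF g) (M.tau k) + galoisAct E (D.augGF g) (M.tau g⁻¹)
      = galoisAct E (D.augGF g) (M.tau k) + (M.tau g + galoisAct E (D.augGF g) (M.tau g⁻¹)) := by abel
    _ = galoisAct E (D.augGF g) (M.tau k) := by rw [← h3, add_zero]

/-! ### §E. `Π_{X_F}` normalises `Π_{X_K}`; `Π_{X̲_K} ⊴ Π_{X_K}` -/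

/-- Conjugation by `g ∈ Π_{X_F}` preserves `Π_{X_K} = Π_{X_F} ∩ augGF⁻¹(G_K)` (`G_K ⊴ G_F`: the kernel of the mod-`l`
representation). ([IUTchI] Def 3.1 (c)(d) p.62) [claim: Mochizuki2012, status: disputed] -/
theorem conj_mem_PiXK_iff {g : D.PiC} (hg : g ∈ D.geom.PiX) (x : D.PiC) : g * x * g⁻¹ ∈ D.PiXK ↔ x ∈ D.PiXK := by
  have hX : g * x * g⁻¹ ∈ D.geom.PiX ↔ x ∈ D.geom.PiX := by
    rw [Subgroup.mul_mem_cancel_right _ (inv_mem hg), Subgroup.mul_mem_cancel_left _ hg]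
  have hC : g * x * g⁻¹ ∈ D.PiCK ↔ x ∈ D.PiCK := by
    rw [D.PiCK_eq_comap_augGF, Subgroup.mem_comap, Subgroup.mem_comap, map_mul, map_mul, map_inv,
      D.mem_galoisSubgroupOf_iff_fixesTorsion, D.mem_galoisSubgroupOf_iff_fixesTorsion, fixesTorsion_conj_iff]
  change g * x * g⁻¹ ∈ D.geom.PiX ⊓ D.PiCK ↔ x ∈ D.geom.PiX ⊓ D.PiCK
  rw [Subgroup.mem_inf, Subgroup.mem_inf, hX, hC]

include M in
/-- **`Π_{X̲_K} ⊴ Π_{X_K}`** («`X̲_K → X_K` … Galois», [EtTh] Rmk 2.1.1; the instance binder of abc-iut-L5-t4's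
`toFlStarGlobal`) FROM the datum: `Π_{X̲_K}` is the kernel of the homomorphism `k ↦ τ k mod 𝔽_l·gen` on `Π_{X_K}`.
([IUTchI] Def 6.1 (v) p.158) [claim: Mochizuki2012, status: disputed] -/
theorem normal_PiXund_subgroupOf_PiXK : (D.PiXund.subgroupOf D.PiXK).Normal := by
  constructor
  intro x hx k
  rw [Subgroup.mem_subgroupOf] at hx ⊢
  have hkK : (k : D.PiC) ∈ D.PiXK := k.2
  have hxK : (x : D.PiC) ∈ D.PiXK := x.2
  obtain ⟨a, ha⟩ := (M.mem_PiXund_iff x hxK).mp hx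
  change (k : D.PiC) * x * (k : D.PiC)⁻¹ ∈ D.PiXund
  refine (M.mem_PiXund_iff _ (mul_mem (mul_mem hkK hxK) (inv_mem hkK))).mpr ⟨a, ?_⟩
  rw [M.tau_mul_of_mem_PiXK (mul_mem hkK hxK) (PiXK_le_PiX (inv_mem hkK)),
    M.tau_mul_of_mem_PiXK hkK (PiXK_le_PiX hxK), M.tau_inv_of_mem_PiXK hkK, ha]
  abel

/-! ### §F. The split-torus sentence `hT` of G-w4d065g3-1, DERIVED -/

/-- If `σ·T ≡ u·T (mod 𝔽_l·gen)` for all `l`-torsion `T` (`u` a unit), then `T ∈ ℤ·gen ↔ σ·T ∈ ℤ·gen` for `l`-torsion `T`: a torus element of the Borel subgroup stabilises the line EXACTLY. ([IUTchI] Def 6.1 (v) p.158) [claim: Mochizuki2012, status: disputed] -/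
theorem mem_line_iff_of_torus {σ : Fbar ≃ₐ[F] Fbar} {u : (ZMod l)ˣ}
    (hσ : ∀ T : GeomPoints Fbar E, (l : ℤ) • T = 0 →
      ∃ m : ℤ, galoisAct E σ T - ((u : ZMod l).val : ℤ) • T = m • M.gen)
    {T : GeomPoints Fbar E} (hT : (l : ℤ) • T = 0) :
    (∃ a : ℤ, T = a • M.gen) ↔ ∃ a : ℤ, galoisAct E σ T = a • M.gen := by
  haveI : NeZero l := ⟨D.l_prime.ne_zero⟩
  obtain ⟨m₀, hm₀⟩ := hσ M.gen M.gen_torsion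
  have hσgen : galoisAct E σ M.gen = (m₀ + ((u : ZMod l).val : ℤ)) • M.gen := by
    rw [add_zsmul, ← hm₀, sub_add_cancel]
  constructor
  · rintro ⟨a, rfl⟩
    exact ⟨a * (m₀ + ((u : ZMod l).val : ℤ)), by rw [map_zsmul, hσgen, mul_zsmul]⟩
  · rintro ⟨a, ha⟩
    obtain ⟨m, hm⟩ := hσ T hT
    rw [ha] at hm
    -- `u·T = (a - m)·gen`, hence `T = u⁻¹u·T = u⁻¹(a - m)·gen`
    have huT : (((u : ZMod l).val : ℤ)) • T = (a - m) • M.gen := by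
      rw [sub_zsmul, ← hm]; abel
    have ht := dvd_val_inv_mul_val_sub_one u
    refine ⟨(((u⁻¹ : (ZMod l)ˣ) : ZMod l).val : ℤ) * (a - m), ?_⟩
    rw [mul_zsmul, ← huT, ← mul_zsmul, zsmul_eq_zsmul_of_dvd_sub E hT ht, one_zsmul]

include M in
/-- **G-w4d065g3-1's `hT`, DERIVED from the torsion monodromy and Def 3.1 (c)**: for every unit `u ∈ 𝔽_l^×` some
`n ∈ N_{Π_{C_F}}(Π_{X̲_K})` (indeed `n ∈ Π_{X_F}`, a lift of a split-torus element of the Borel subgroup of `SL₂(𝔽_l)` at the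
line defining `X̲_K`) acts on the rank-one quotient `Π_{X_K}/Π_{X̲_K} ≅ ℤ/l` by `k ↦ k^u` — print: «it follows from the
construction of `X̲_K` that … the image … contains a Borel subgroup of `SL₂(𝔽_l)/{±1}`».
([IUTchI] Def 6.1 (v) p.158) [claim: Mochizuki2012, status: disputed] -/
theorem forall_exists_conj : ∀ u : (ZMod l)ˣ, ∃ n : D.PiC,
    n ∈ Subgroup.normalizer ((D.PiXund : Subgroup D.PiC) : Set D.PiC) ∧
      ∀ k ∈ D.PiXK, (k ^ (u : ZMod l).val)⁻¹ * (n * k * n⁻¹) ∈ D.PiXund := by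
  intro u
  obtain ⟨σ, hσ⟩ := M.exists_galois_torus u
  -- lift `σ` to `g ∈ Π_{X_F}` (`Π_{X_F} ↠ G_F`)
  have hσmem : σ ∈ D.geom.PiX.map D.augGF := by rw [D.map_augGF_PiX]; exact Subgroup.mem_top σ
  obtain ⟨g, hg, rfl⟩ := Subgroup.mem_map.mp hσmem
  refine ⟨g, ?_, fun k hk => ?_⟩
  · rw [Subgroup.mem_normalizer_iff]
    intro x
    constructor
    · intro hx
      have hxK : x ∈ D.PiXK := D.PiXund_le_PiXK hx
      have hcK : g * x * g⁻¹ ∈ D.PiXK := (conj_mem_PiXK_iff hg x).mpr hxK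
      refine (M.mem_PiXund_iff _ hcK).mpr ?_
      rw [M.tau_conj hg hxK]
      exact (M.mem_line_iff_of_torus hσ (M.tau_torsion x (PiXK_le_PiX hxK))).mp ((M.mem_PiXund_iff x hxK).mp hx)
    · intro hc
      have hcK : g * x * g⁻¹ ∈ D.PiXK := D.PiXund_le_PiXK hc
      have hxK : x ∈ D.PiXK := (conj_mem_PiXK_iff hg x).mp hcK
      refine (M.mem_PiXund_iff x hxK).mpr ?_
      refine (M.mem_line_iff_of_torus hσ (M.tau_torsion x (PiXK_le_PiX hxK))).mpr ?_
      rw [← M.tau_conj hg hxK]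
      exact (M.mem_PiXund_iff _ hcK).mp hc
  · have hcK : g * k * g⁻¹ ∈ D.PiXK := (conj_mem_PiXK_iff hg k).mpr hk
    have hpK : (k ^ (u : ZMod l).val)⁻¹ ∈ D.PiXK := inv_mem (pow_mem hk _)
    refine (M.mem_PiXund_iff _ (mul_mem hpK hcK)).mpr ?_
    obtain ⟨m, hm⟩ := hσ (M.tau k) (M.tau_torsion k (PiXK_le_PiX hk))
    refine ⟨m, ?_⟩
    rw [M.tau_mul_of_mem_PiXK hpK (PiXK_le_PiX hcK), M.tau_inv_of_mem_PiXK (pow_mem hk _),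
      M.tau_pow_of_mem_PiXK hk, M.tau_conj hg hk, ← hm]
    abel

end TorsionMonodromy

/-! ### §G. Def 6.1 (v) at the genuine data: `Aut(𝒟^{⊚±}) ↠ 𝔽_l^⋇` from the torsion monodromy -/

/-- **[IUTchI] Def 6.1 (v) «this rank one quotient determines a natural surjective homomorphism `Aut(𝒟^{⊚±}) ↠ 𝔽_l^⋇`» AT
THE GENUINE INITIAL Θ-DATA, from the torsion-monodromy datum** (abc-iut-w4-d065's reduction p428973 + `forall_exists_conj`):
the kit axiom `PMBaseKit.toFlStar_surjective` at `G := gModel` no longer needs the opaque binder `hT`.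
([IUTchI] Def 6.1 (v) p.158) [claim: Mochizuki2012, status: disputed] -/
theorem toFlStarGlobal_surjective_of_torsionMonodromy [Fact l.Prime] [(D.PiXund.subgroupOf D.PiXK).Normal]
    (M : D.TorsionMonodromy) : Function.Surjective D.toFlStarGlobal :=
  D.toFlStarGlobal_surjective_of_forall_exists_conj M.forall_exists_conj

/-- … hence **`[Aut(𝒟^{⊚±}) : Aut_±(𝒟^{⊚±})] = l⋇`** at the genuine data. ([IUTchI] Def 6.1 (v) p.158) [claim: Mochizuki2012, status: disputed] -/
theorem index_ker_toFlStarGlobal_of_torsionMonodromy [Fact l.Prime] [(D.PiXund.subgroupOf D.PiXK).Normal]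
    (M : D.TorsionMonodromy) : (D.toFlStarGlobal).ker.index = lStar l :=
  D.index_ker_toFlStarGlobal_of_surjective (by have := D.five_le_l; omega)
    (D.toFlStarGlobal_surjective_of_torsionMonodromy M)

end InitialThetaData

end TorsionMonodromy

end Literature.IUT.HodgeTheaters
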